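import Literature.MathematicalPhysics.QuantumFieldTheory.Z2FiniteTemperatureIsingStack
import Literature.MathematicalPhysics.QuantumFieldTheory.FiniteTemperatureAbelianCentreDomination
import Literature.Barriers.QuantumFields.FiniteTemperatureDeconfinementHolds
import Literature.MathematicalPhysics.QuantumFieldTheory.AbelianFiniteTemperatureDeconfinement
import HarnessLib

/-!
# Temperature-independent Polyakov confinement windows for `U(N)` and `SU(2m)` from the centre:
# `|G_L^{G}(x; J_E, J_M)| ≤ N² (⟨σ_0σ_x⟩^{Ising}_{N J_E})^{L₀}`, hence confinement at every temporal
# extent and every magnetic coupling whenever `N·J_E < β_c(d)`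

Composition file (theorems; two small definitions: the isomorphism `ℤ₂ ≅ {±1} ⊂ U(1)`), in the
vocabulary of `Literature.Barriers.QuantumFields.FiniteTemperature` (Borgs–Seiler's lattice
`ℤ_{L₀} × (ℤ/L)^d`, Wilson action with electric/magnetic couplings `J_E`, `J_M`, Polyakov two-point
function `polyakovCorrelation` (II.22)). It composes three results of the tree:

1. **Centre domination at finite temperature** (Fröhlich 1979 / Grosse 1988 (4.134) on Borgs–Seiler's
   lattice; tree `ThermalCentre.abs_polyakovCorrelation_le_zn_of_neZero`,
   `specialUnitaryGroup_abs_polyakovCorrelation_le_zn_of_neZero`): for a compact `G` with a central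
   cyclic subgroup `ℤ_n` on which `ρ` acts by the defining character,
   `|G_L^{G,ρ}(x; J_E, J_M)| ≤ N² · G_L^{ℤ_n}(x; N J_E, N J_M)`.
2. **The `J_M → ∞` Griffiths bound for `ℤ₂`** (Borgs–Seiler §IV p. 359 "implied by Ginibre's
   inequalities"; tree `z2_polyakovCorrelation_le_isingTorus_pow`, this seat):
   `G_L^{ℤ₂}(x; J, J') ≤ (⟨σ_0σ_x⟩^{Ising}_{(ℤ/L)^d, J})^{L₀}`.
3. **Sharp subcritical decay of the Ising model on tori** (tree `exists_uniform_decay_isingTorusTwoPoint`,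
   Aizenman–Barsky–Fernández / Duminil-Copin–Tassion, via `z2_polyakovCorrelation_decay_of_lt_criticalBeta`).

Item 1 is stated in the tree for `ℤ_n = rootsOfUnityCircle n ⊂ U(1)` (`znRep n`), item 2 for
`ℤ₂ = Multiplicative (ZMod 2)` (`z2Rep`); §§1–2 of this file supply the (elementary) bridge: the
finite-temperature Polyakov correlation is invariant under isomorphisms of FINITE gauge groups
(`ThermalTransport.polyakovCorrelation_comp_mulEquiv`, reindexing the finite Gibbs sum), and
`ℤ₂ ≅ {±1}` with `znRep 2 ∘ ≅ = z2Rep` (`polyakovCorrelation_znRep_two_eq_z2Rep`).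

## Results (§3)

* `zn2_polyakovCorrelation_le_isingTorus_pow` — item 2 for `znRep 2`.
* ★ `suN_abs_polyakovCorrelation_le_isingTorus_pow_of_even` (`SU(N)`, `N` even, via `ℤ₂ ⊆ ℤ_N`),
  `su2_abs_polyakovCorrelation_le_isingTorus_pow`, ★ `unitaryGroup_abs_polyakovCorrelation_le_isingTorus_pow`
  (`U(N)`, every `N ≥ 1`, via `{±1} ⊂ U(N)`): **`|G_L^{G}(x; J_E, J_M)| ≤ N² · (⟨σ_0σ_x⟩^{Ising}_{(ℤ/L)^d, N J_E})^{L₀}`**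
  for all `J_E, J_M ≥ 0`, `L ≥ 3`, every `L₀ ≥ 1` and every `x`.
* ★ `suN_tendsto_zero_of_even_of_lt_criticalBeta`, `su2_tendsto_zero_of_lt_criticalBeta`,
  `unitaryGroup_tendsto_zero_of_lt_criticalBeta` — **temperature-independent confinement windows**:
  for `d ≥ 2`, `0 ≤ J_E` with `N · J_E < β_c(d)` (`criticalBeta d`, the Ising critical point of `ℤ^d`),
  EVERY `J_M ≥ 0` and EVERY temporal extent `L₀`, every thermodynamic limit of the Polyakov two-point
  function tends to `0` (Polyakov's criterion (II.23): confinement) — Borgs–Seiler (II.55)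
  "Irrespective of `J_M` and temperature we are sure to have confinement for `J_E < J_c`" with the
  explicit, `L₀`-independent `J_c = β_c(d)/N` obtained from correlation inequalities instead of a
  cluster expansion; and (`suN_criticalBeta_le_of_even_of_hasPolyakovLongRangeOrder`,
  `su2_criticalBeta_le_of_hasPolyakovLongRangeOrder`, `unitaryGroup_criticalBeta_le_of_hasPolyakovLongRangeOrder`)
  Polyakov long-range order (Borgs–Seiler's deconfinement, tree `FiniteTemperatureDeconfinement_holds`)
  forces `N · J_E ≥ β_c(d)` — a lower bound on the deconfining electric coupling of `SU(2)`, `SU(2m)`,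
  `U(N)`, uniform in the temperature, complementing Borgs–Seiler's upper bounds (III.62)–(III.65).

## Results (§4): central involutions — the general theorem; `U(1)` and `ℤ_{2m}`

* ★ `abs_polyakovCorrelation_le_isingTorus_pow_of_centralSign` — the GENERAL form of §3: for every
  compact second-countable `G`, every continuous unitary `ρ : G → U(N)` and every homomorphism
  `ι : {±1} → Z(G)` with `ρ(ι(z)) = z·1` (a central involution represented by `−1`; `U(N)`, `SU(2m)`,
  `U(1)`, `ℤ_{2m}`, `Sp(N)`, …), `|G_L^{G,ρ}(x; J_E, J_M)| ≤ N² (⟨σ_0σ_x⟩^{Ising}_{(ℤ/L)^d, N J_E})^{L₀}`;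
  `tendsto_zero_of_centralSign_of_lt_criticalBeta` (confinement at every `L₀`, every `J_M ≥ 0` for
  `N J_E < β_c(d)`), `criticalBeta_le_of_centralSign_of_hasPolyakovLongRangeOrder`.
* `U(1)` (`u1Rep`, `N = 1`, `ι = {±1} ⊂ U(1)`): `u1_polyakovCorrelation_le_isingTorus_pow`
  (`0 ≤ G_L^{U(1)} ≤ (⟨σ_0σ_x⟩^{Ising}_{J_E})^{L₀}`), `u1_tendsto_zero_of_lt_criticalBeta`,
  `u1_criticalBeta_le_of_hasPolyakovLongRangeOrder`, and with the seat's abelian deconfinement theorem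
  (`u1_hasPolyakovLongRangeOrder_of_lt`, Borgs–Seiler Lemma III.9) the **two-sided window for the `U(1)`
  finite-temperature transition** `u1_transition_window` (`d ≥ 3`, every `L₀`: no Polyakov long-range
  order for `J_E < β_c(d)`, long-range order for `J_E > 2L₀(d·I_d + 1)`, `J_M > 0`), whence the
  curiosity `criticalBeta_le_of_u1_deconfinement`: `β_c(d) ≤ 2L₀(d·I_d + 1) + 1` for every `L₀ ≥ 1`
  (the `d`-dimensional Ising critical point bounded through `d+1`-dimensional `U(1)` gauge theory).
* `ℤ_n`, `n` even (`znRep n`, `{±1} ⊆ ℤ_n`): `zn_polyakovCorrelation_le_isingTorus_pow_of_even`,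
  `zn_tendsto_zero_of_even_of_lt_criticalBeta`, `zn_criticalBeta_le_of_even_of_hasPolyakovLongRangeOrder`,
  `zn_transition_window_of_even`.

## Honest framing

These are STRONG-COUPLING-SIDE statements (a confinement window `N J_E < β_c(d)`), obtained for
non-abelian groups only through their centre; their point is the uniformity in the temporal extent
`L₀` and in `J_M` and the sharp Ising constant, not the regime. `SU(N)` with `N` odd (centre `ℤ_N`
without an involution) is not covered: the `ℤ_N` analogue of item 2 needs Griffiths' inequalities for
`ℤ_N` clock-type models in the frozen form, available in the tree only through Ginibre for odd `n`
/ square-root extensions, and a subcritical-sharpness input for clock models that the tree does not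
have — not attempted. Nothing here bears on the weak-coupling/continuum regime, on `3+1`-dimensional
Yang–Mills at zero temperature beyond `σ_P`, or on the Yang–Mills mass gap (Clay), which is NOT
proved by any of this; in the `ym` ladder only the conditional finite-`𝕋⁴` rung `BalabanLadder.UV`
is closed.

## References

* C. Borgs, E. Seiler, Commun. Math. Phys. 91 (1983) 329–380: §II.3 (II.22)–(II.23) p. 337; §II.4
  (II.55)–(II.56) p. 343; §IV pp. 358–359. [BorgsSeiler1983]
* J. Fröhlich, Phys. Lett. B 83 (1979) 195; H. Grosse, *Models in Statistical Physics and Quantum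
  Field Theory* (1988) §4.2.4 (4.134). [Frohlich1979ZN] [Grosse1988]
* M. Aizenman, H. Duminil-Copin, Ann. of Math. 194 (2021), Prop. 5.2. [AizenmanDuminilCopinAnnals2021]
-/

noncomputable section

open MeasureTheory Filter Finset
open scoped Topology
open Literature.Probability.LatticeModels Literature.MathematicalPhysics.QuantumLattice
open Literature.Barriers.QuantumFields Literature.Barriers.QuantumFields.FiniteTemperature

namespace Literature.MathematicalPhysics.QuantumFieldTheory

/-! ### 1. Transport along an isomorphism of finite gauge groups -/

namespace ThermalTransport

variable {d L₀ L : ℕ} {H G : Type*} [Group H] [Group G] {N : ℕ}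
  (ρ : G →* Matrix (Fin N) (Fin N) ℂ) (e : H ≃* G)

/-- `(e∘V)_P = e(V_P)`. [folklore] -/
private theorem plaquette_map (V : Config d L₀ L H) (x : FiniteTemperature.Site d L₀ L) (μ ν : Dir d) :
    plaquette (fun l => e (V l)) x μ ν = e (plaquette V x μ ν) := by
  simp only [plaquette, map_mul, map_inv]

/-- `hol(e∘V) = e(hol V)` for time-like holonomies. [folklore] -/
private theorem timeHolonomy_map (V : Config d L₀ L H) :
    ∀ (n : ℕ) (y : FiniteTemperature.Site d L₀ L), timeHolonomy (fun l => e (V l)) n y = e (timeHolonomy V n y)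
  | 0, _ => by simp [timeHolonomy]
  | n + 1, y => by
      show e (V (y, none)) * timeHolonomy (fun l => e (V l)) n (y.shift none) =
        e (V (y, none) * timeHolonomy V n (y.shift none))
      rw [timeHolonomy_map V n, map_mul]

/-- The Wilson weight of `ρ ∘ e` at `V` is the weight of `ρ` at `e ∘ V`. [folklore] -/
private theorem weight_comp [NeZero L₀] [NeZero L] (JE JM : ℝ) (V : Config d L₀ L H) :
    weight (ρ.comp e.toMonoidHom) JE JM V = weight ρ JE JM (fun l => e (V l)) := by
  simp only [weight, minusAction, MonoidHom.coe_comp, MulEquiv.coe_toMonoidHom, Function.comp_apply,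
    plaquette_map]

/-- The traced Polyakov loop of `ρ ∘ e` at `V` is that of `ρ` at `e ∘ V`. [folklore] -/
private theorem polyakovTrace_comp (V : Config d L₀ L H) (x : Fin d → ZMod L) :
    polyakovTrace (ρ.comp e.toMonoidHom) V x = polyakovTrace ρ (fun l => e (V l)) x := by
  simp only [polyakovTrace, polyakovLine, MonoidHom.coe_comp, MulEquiv.coe_toMonoidHom,
    Function.comp_apply, timeHolonomy_map]

variable [Fintype H] [Fintype G] [TopologicalSpace H] [TopologicalSpace G] [DiscreteTopology H]
  [DiscreteTopology G] [IsTopologicalGroup H] [IsTopologicalGroup G] [MeasurableSpace H]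
  [MeasurableSpace G] [BorelSpace H] [BorelSpace G]

/-- **The finite-temperature Polyakov correlation is invariant under isomorphisms of finite gauge
groups**: `G_L^{H, ρ∘e}(x; J_E, J_M) = G_L^{G, ρ}(x; J_E, J_M)` for `e : H ≃* G` (reindex the finite
Gibbs sums along `V ↦ e ∘ V`): the two-point function (II.22) depends on the gauge group only up to
isomorphism. [cite: BorgsSeiler1983, §II.3 (II.22) (p. 337)] -/
theorem polyakovCorrelation_comp_mulEquiv [NeZero L₀] [NeZero L] (JE JM : ℝ) (x : Fin d → ZMod L) :
    polyakovCorrelation (L₀ := L₀) (ρ.comp e.toMonoidHom) JE JM x =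
      polyakovCorrelation (L₀ := L₀) ρ JE JM x := by
  rw [polyakovCorrelation, polyakovCorrelation, Z2Thermal.expectation_eq_sum_div,
    Z2Thermal.expectation_eq_sum_div]
  set E : Config d L₀ L H ≃ Config d L₀ L G := Equiv.piCongrRight fun _ => e.toEquiv with hE
  have hEap : ∀ V : Config d L₀ L H, E V = fun l => e (V l) := fun V => rfl
  rw [← E.sum_comp (fun U => (polyakovTrace ρ U 0 * starRingEnd ℂ (polyakovTrace ρ U x)).re * weight ρ JE JM U),
    ← E.sum_comp (fun U => weight ρ JE JM U)]
  simp only [hEap, weight_comp, polyakovTrace_comp]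

end ThermalTransport

/-! ### 2. `ℤ₂ = Multiplicative (ZMod 2)` is `{±1} = rootsOfUnityCircle 2 ⊂ U(1)` -/

section Z2Roots

open Z2Thermal

/-- `(-1 : U(1))² = 1`. [folklore] -/
private theorem neg_one_mul_neg_one_circle : (-1 : Circle) * (-1 : Circle) = 1 := by
  rw [neg_mul_neg, one_mul]

/-- `(-1 : U(1))^m` depends only on `m mod 2`. [folklore] -/
private theorem neg_one_pow_mod_two_circle (m : ℕ) : (-1 : Circle) ^ (m % 2) = (-1 : Circle) ^ m := by
  conv_rhs => rw [← Nat.mod_add_div m 2, pow_add, pow_mul]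
  rw [sq, neg_one_mul_neg_one_circle, one_pow, mul_one]

/-- `(-1)^m ∈ {±1}`. [folklore] -/
private theorem neg_one_pow_mem (m : ℕ) : (-1 : Circle) ^ m ∈ rootsOfUnityCircle 2 := by
  rw [mem_rootsOfUnityCircle, ← pow_mul, mul_comm, pow_mul, sq, neg_one_mul_neg_one_circle, one_pow]

/-- The isomorphism `ℤ₂ → {±1} ⊂ U(1)`, `a ↦ (−1)^a`, as a homomorphism. [folklore] -/
def z2RootsHom : Z2 →* ↥(rootsOfUnityCircle 2) where
  toFun a := ⟨(-1 : Circle) ^ a.toAdd.val, neg_one_pow_mem _⟩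
  map_one' := Subtype.ext (by simp)
  map_mul' a b := Subtype.ext (by
    simp only [toAdd_mul, ZMod.val_add, Subgroup.coe_mul, ← pow_add, neg_one_pow_mod_two_circle])

/-- `z2RootsHom a = (−1)^a` in `U(1)`. [folklore] -/
@[simp] private theorem coe_z2RootsHom (a : Z2) : ((z2RootsHom a : ↥(rootsOfUnityCircle 2)) : Circle) = (-1 : Circle) ^ a.toAdd.val := rfl

/-- `z2RootsHom` is a bijection onto `{±1}`. [folklore] -/
private theorem z2RootsHom_bijective : Function.Bijective z2RootsHom := by
  constructor
  · intro a b h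
    have hv := congrArg (fun z : ↥(rootsOfUnityCircle 2) => (z : Circle)) h
    simp only [coe_z2RootsHom] at hv
    -- `a.val, b.val ∈ {0,1}` and `(-1)^0 ≠ (-1)^1`
    have ha := ZMod.val_lt (Multiplicative.toAdd a)
    have hb := ZMod.val_lt (Multiplicative.toAdd b)
    have hne : (-1 : Circle) ≠ 1 := Circle.neg_ne_self 1
    have key : (Multiplicative.toAdd a).val = (Multiplicative.toAdd b).val := by
      rcases Nat.lt_succ_iff.1 ha |> Nat.le_one_iff_eq_zero_or_eq_one.1 with h0 | h1 <;>
        rcases Nat.lt_succ_iff.1 hb |> Nat.le_one_iff_eq_zero_or_eq_one.1 with k0 | k1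
      · rw [h0, k0]
      · rw [h0, k1, pow_zero, pow_one] at hv; exact absurd hv.symm hne
      · rw [h1, k0, pow_zero, pow_one] at hv; exact absurd hv hne
      · rw [h1, k1]
    exact Multiplicative.toAdd.injective (ZMod.val_injective 2 key)
  · rintro ⟨z, hz⟩
    have hz2 : (z : ℂ) ^ 2 = 1 := by
      have := congrArg (fun u : Circle => (u : ℂ)) (mem_rootsOfUnityCircle.1 hz)
      simpa using this
    rcases sq_eq_one_iff.1 hz2 with h | h
    · exact ⟨Multiplicative.ofAdd 0, Subtype.ext (Circle.ext (by simp [h]))⟩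
    · exact ⟨Multiplicative.ofAdd 1, Subtype.ext (Circle.ext (by
        rw [coe_z2RootsHom, toAdd_ofAdd, show (1 : ZMod 2).val = 1 from rfl, pow_one, Circle.coe_neg,
          Circle.coe_one, h]))⟩

/-- The isomorphism `ℤ₂ ≅ {±1} ⊂ U(1)`. [folklore] -/
def z2RootsEquiv : Z2 ≃* ↥(rootsOfUnityCircle 2) := MulEquiv.ofBijective z2RootsHom z2RootsHom_bijective

/-- `(−1 : U(1))^a` as a complex number. [folklore] -/
private theorem coe_coe_z2RootsHom (a : Z2) :
    (((z2RootsHom a : ↥(rootsOfUnityCircle 2)) : Circle) : ℂ) = (-1 : ℂ) ^ a.toAdd.val := by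
  rw [coe_z2RootsHom]
  rcases Nat.le_one_iff_eq_zero_or_eq_one.1 (Nat.lt_succ_iff.1 (ZMod.val_lt (Multiplicative.toAdd a)))
    with h | h
  · rw [h, pow_zero, pow_zero, Circle.coe_one]
  · rw [h, pow_one, pow_one, Circle.coe_neg, Circle.coe_one]

/-- `znRep 2 ∘ (ℤ₂ ≅ {±1}) = z2Rep` (both send the generator to the `1 × 1` matrix `−1`). [folklore] -/
private theorem znRep_two_comp_z2RootsEquiv : (znRep 2).comp z2RootsEquiv.toMonoidHom = z2Rep := by
  refine MonoidHom.ext fun a => ?_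
  rw [MonoidHom.comp_apply, MulEquiv.coe_toMonoidHom, z2RootsEquiv, MulEquiv.ofBijective_apply,
    znRep_apply, u1Rep_apply, z2Rep_apply, coe_coe_z2RootsHom, Matrix.scalar_apply]
  ext i j
  simp [Matrix.diagonal_apply, Matrix.one_apply]

variable {d L₀ L : ℕ}

/-- **The `ℤ₂` Polyakov correlation (II.22) in the tree's two spellings of `ℤ₂`**:
`G_L^{ℤ₂ ⊂ U(1), znRep 2} = G_L^{ℤ₂, z2Rep}`. [cite: BorgsSeiler1983, §II.3 (II.22) (p. 337)] -/
theorem polyakovCorrelation_znRep_two_eq_z2Rep [NeZero L₀] [NeZero L] (JE JM : ℝ) (x : Fin d → ZMod L) :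
    polyakovCorrelation (L₀ := L₀) (znRep 2) JE JM x = polyakovCorrelation (L₀ := L₀) z2Rep JE JM x := by
  haveI : Fintype ↥(rootsOfUnityCircle 2) := Fintype.ofFinite _
  rw [← znRep_two_comp_z2RootsEquiv]
  exact (ThermalTransport.polyakovCorrelation_comp_mulEquiv (d := d) (L₀ := L₀) (L := L) (znRep 2)
    z2RootsEquiv JE JM x).symm

end Z2Roots

/-! ### 3. Centre ∘ stack: `|G^{G}| ≤ N² (Ising_{N J_E})^{L₀}` and the confinement windows -/

section CentreIsing

open Z2Thermal

variable {d L₀ L : ℕ}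

/-- The `J_M → ∞` Ising bound for `ℤ₂ ⊂ U(1)` (`znRep 2`): `G_L(x; J_E, J_M) ≤ (⟨σ_0σ_x⟩^{Ising}_{J_E})^{L₀}`.
[cite: BorgsSeiler1983, §IV (pp. 358–359)] -/
theorem zn2_polyakovCorrelation_le_isingTorus_pow [NeZero L₀] [NeZero L] (hL : 3 ≤ L) {JE JM : ℝ}
    (hJE : 0 ≤ JE) (hJM : 0 ≤ JM) (x : Fin d → ZMod L) :
    polyakovCorrelation (L₀ := L₀) (znRep 2) JE JM x ≤ torusTwoPoint (isingTorusMeasure d L JE 0) x ^ L₀ := by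
  rw [polyakovCorrelation_znRep_two_eq_z2Rep]
  exact z2_polyakovCorrelation_le_isingTorus_pow hL hJE hJM x

/-- ★ **`SU(N)`, `N` even: the Polyakov correlation is dominated by the stack of Ising layers at the
`N`-fold coupling**: `|G_L^{SU(N)}(x; J_E, J_M)| ≤ N² (⟨σ_0σ_x⟩^{Ising}_{(ℤ/L)^d, N J_E})^{L₀}` for
`J_E, J_M ≥ 0`, `L ≥ 3`, every `L₀`, every `x` (centre domination to `ℤ₂ ⊆ ℤ_N` ∘ the `J_M → ∞` Griffiths
bound). [cite: Grosse1988, §4.2.4 eq. (4.134)] [cite: BorgsSeiler1983, §IV (pp. 358–359)] -/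
theorem suN_abs_polyakovCorrelation_le_isingTorus_pow_of_even [NeZero L₀] [NeZero L] {N : ℕ} (hN : 2 ∣ N)
    (hL : 3 ≤ L) {JE JM : ℝ} (hJE : 0 ≤ JE) (hJM : 0 ≤ JM) (x : Fin d → ZMod L) :
    |polyakovCorrelation (L₀ := L₀) (fundamentalRep (Fin N)) JE JM x| ≤
      (N : ℝ) ^ 2 * torusTwoPoint (isingTorusMeasure d L ((N : ℝ) * JE) 0) x ^ L₀ :=
  (specialUnitaryGroup_abs_polyakovCorrelation_le_zn_of_neZero (L₀ := L₀) hN hJE hJM x).trans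
    (mul_le_mul_of_nonneg_left (zn2_polyakovCorrelation_le_isingTorus_pow hL (by positivity) (by positivity) x)
      (by positivity))

/-- ★ **`SU(2)`**: `|G_L^{SU(2)}(x; J_E, J_M)| ≤ 4 (⟨σ_0σ_x⟩^{Ising}_{(ℤ/L)^d, 2J_E})^{L₀}`.
[cite: Grosse1988, §4.2.4 eq. (4.134)] [cite: BorgsSeiler1983, §IV (pp. 358–359)] -/
theorem su2_abs_polyakovCorrelation_le_isingTorus_pow [NeZero L₀] [NeZero L] (hL : 3 ≤ L) {JE JM : ℝ}
    (hJE : 0 ≤ JE) (hJM : 0 ≤ JM) (x : Fin d → ZMod L) :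
    |polyakovCorrelation (L₀ := L₀) (fundamentalRep (Fin 2)) JE JM x| ≤
      4 * torusTwoPoint (isingTorusMeasure d L (2 * JE) 0) x ^ L₀ := by
  have h := suN_abs_polyakovCorrelation_le_isingTorus_pow_of_even (L₀ := L₀) (dvd_refl 2) hL hJE hJM x
  norm_num at h
  exact h

/-- The scalar `{±1} ⊂ U(N)`: `z ↦ z·1`. [folklore] -/
private def pmOneUnitary (N : ℕ) : ↥(rootsOfUnityCircle 2) →* Matrix.unitaryGroup (Fin N) ℂ :=
  (scalarUnitaryHom (n := Fin N)).comp (rootsOfUnityCircle 2).subtype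

/-- `{±1}·1` is central in `U(N)`. [folklore] -/
private theorem pmOneUnitary_mem_center (N : ℕ) (z : ↥(rootsOfUnityCircle 2)) :
    pmOneUnitary N z ∈ Subgroup.center (Matrix.unitaryGroup (Fin N) ℂ) := by
  rw [Subgroup.mem_center_iff]
  intro g
  apply Subtype.ext
  simp only [pmOneUnitary, MonoidHom.coe_comp, Function.comp_apply, Subgroup.coe_subtype,
    Submonoid.coe_mul, scalarUnitaryHom_apply, coe_scalarUnitary, Matrix.mul_smul, Matrix.mul_one,
    Matrix.smul_mul, Matrix.one_mul]

/-- ★ **`U(N)`, every `N`: `|G_L^{U(N)}(x; J_E, J_M)| ≤ N² (⟨σ_0σ_x⟩^{Ising}_{(ℤ/L)^d, N J_E})^{L₀}`**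
(centre domination to `{±1} ⊂ U(N)` ∘ the `J_M → ∞` Griffiths bound). [cite: Grosse1988, §4.2.4 eq. (4.134)] [cite: BorgsSeiler1983, §IV (pp. 358–359)] -/
theorem unitaryGroup_abs_polyakovCorrelation_le_isingTorus_pow [NeZero L₀] [NeZero L] {N : ℕ} (hL : 3 ≤ L)
    {JE JM : ℝ} (hJE : 0 ≤ JE) (hJM : 0 ≤ JM) (x : Fin d → ZMod L) :
    |polyakovCorrelation (L₀ := L₀) (unitaryFundamentalRep (Fin N) ℂ) JE JM x| ≤
      (N : ℝ) ^ 2 * torusTwoPoint (isingTorusMeasure d L ((N : ℝ) * JE) 0) x ^ L₀ := by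
  have h := ThermalCentre.abs_polyakovCorrelation_le_zn_of_neZero (d := d) (L₀ := L₀) (L := L)
    (unitaryFundamentalRep (Fin N) ℂ) (pmOneUnitary N) (continuous_unitaryFundamentalRep (Fin N) ℂ)
    (fun g => g.2) (pmOneUnitary_mem_center N) (fun _ => rfl) hJE hJM x
  exact h.trans (mul_le_mul_of_nonneg_left
    (zn2_polyakovCorrelation_le_isingTorus_pow hL (by positivity) (by positivity) x) (by positivity))

/-! #### From a volume-uniform decay bound to the decay of every thermodynamic limit -/

/-- If `|G_L(x̄)| ≤ C θ^{L₀⌊‖x‖_∞/(R+1)⌋}` for all large even boxes, `0 ≤ θ < 1`, then every thermodynamic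
limit of `G_L` tends to `0` at spatial infinity. [folklore] -/
private theorem tendsto_zero_of_uniform_decay {G : Type*} [Group G] [TopologicalSpace G] [IsTopologicalGroup G]
    [CompactSpace G] [MeasurableSpace G] [BorelSpace G] [SecondCountableTopology G] {N : ℕ}
    (ρ : G →* Matrix (Fin N) (Fin N) ℂ) (L₀ : ℕ) [NeZero L₀] {JE JM : ℝ} {C θ : ℝ} {R : ℕ}
    (hθ0 : 0 ≤ θ) (hθ1 : θ < 1)
    (hdec : ∀ (L : ℕ) [NeZero L], 2 * R + 4 ≤ L → ∀ x : Literature.Probability.LatticeModels.Site d,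
      2 * Site.supNorm x ≤ L →
        |polyakovCorrelation (L₀ := L₀) ρ JE JM (Torus.proj L x)| ≤ C * θ ^ (L₀ * (Site.supNorm x / (R + 1))))
    {Ginf : (Fin d → ℤ) → ℝ} (hG : IsThermodynamicLimit (d := d) (L₀ := L₀) ρ JE JM Ginf) :
    Tendsto Ginf cofinite (𝓝 0) := by
  obtain ⟨φ, hφ, hlim⟩ := hG
  have hbound : ∀ x : Fin d → ℤ, |Ginf x| ≤ C * θ ^ (L₀ * (Site.supNorm x / (R + 1))) := by
    intro x
    have hev : ∀ᶠ k : ℕ in atTop,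
        |polyakovCorrelation (L₀ := L₀) (L := 2 * φ k + 2) ρ JE JM (fun i => ((x i : ℤ) : ZMod (2 * φ k + 2)))| ≤
          C * θ ^ (L₀ * (Site.supNorm x / (R + 1))) := by
      have h1 : ∀ᶠ k : ℕ in atTop, 2 * R + 4 ≤ 2 * φ k + 2 ∧ 2 * Site.supNorm x ≤ 2 * φ k + 2 := by
        refine eventually_atTop.2 ⟨R + 1 + Site.supNorm x, fun k hk => ?_⟩
        have hk' : k ≤ φ k := hφ.id_le k
        constructor <;> omega
      filter_upwards [h1] with k hk
      exact hdec (2 * φ k + 2) hk.1 x hk.2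
    exact le_of_tendsto ((continuous_abs.tendsto _).comp (hlim x)) hev
  have hθL : θ ^ L₀ < 1 := pow_lt_one₀ hθ0 hθ1 (NeZero.ne L₀)
  have hq : Tendsto (fun x : Fin d → ℤ => Site.supNorm x / (R + 1)) cofinite atTop := by
    refine tendsto_atTop.2 fun n => ?_
    have h := (tendsto_norm_cofinite_atTop (d := d)).eventually_ge_atTop (((n * (R + 1) : ℕ) : ℝ))
    filter_upwards [h] with x hx
    rw [Site.norm_eq_supNorm] at hx
    have hx' : n * (R + 1) ≤ Site.supNorm x := by exact_mod_cast hx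
    exact (Nat.le_div_iff_mul_le (by omega)).2 hx'
  have hmaj : Tendsto (fun x : Fin d → ℤ => C * θ ^ (L₀ * (Site.supNorm x / (R + 1)))) cofinite (𝓝 0) := by
    have h := ((tendsto_pow_atTop_nhds_zero_of_lt_one (pow_nonneg hθ0 L₀) hθL).comp hq).const_mul C
    rw [mul_zero] at h
    refine h.congr fun x => ?_
    simp only [Function.comp_apply, ← pow_mul]
  refine squeeze_zero_norm (fun x => ?_) hmaj
  rw [Real.norm_eq_abs]
  exact hbound x

/-- ★ **`SU(N)`, `N` even: temperature-independent Polyakov confinement for `N J_E < β_c(d)`.** For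
`d ≥ 2`, `2 ∣ N`, `0 ≤ J_E` with `N·J_E < β_c(d)` and every `J_M ≥ 0`, at EVERY temporal extent `L₀`,
every thermodynamic limit of the `SU(N)` Polyakov two-point function tends to `0`. [cite: BorgsSeiler1983, §II.4 (II.55)–(II.56) (p. 343); §IV (pp. 358–359)] -/
theorem suN_tendsto_zero_of_even_of_lt_criticalBeta (hd : 2 ≤ d) {N : ℕ} (hN : 2 ∣ N) (L₀ : ℕ) [NeZero L₀]
    {JE JM : ℝ} (hJE : 0 ≤ JE) (hJEc : (N : ℝ) * JE < criticalBeta d) (hJM : 0 ≤ JM)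
    {Ginf : (Fin d → ℤ) → ℝ} (hG : IsThermodynamicLimit (d := d) (L₀ := L₀) (fundamentalRep (Fin N)) JE JM Ginf) :
    Tendsto Ginf cofinite (𝓝 0) := by
  obtain ⟨R, θ, hR, hθ0, hθ1, hdec⟩ :=
    z2_polyakovCorrelation_decay_of_lt_criticalBeta hd (by positivity : 0 ≤ (N : ℝ) * JE) hJEc
  refine tendsto_zero_of_uniform_decay (d := d) (fundamentalRep (Fin N)) L₀ (C := (N : ℝ) ^ 2) (R := R)
    hθ0 hθ1 (fun L _ hL x hx => ?_) hG
  have hL3 : 3 ≤ L := by omega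
  have h2 := (hdec L₀ ((N : ℝ) * JM) (by positivity) L hL x hx).2
  calc |polyakovCorrelation (L₀ := L₀) (fundamentalRep (Fin N)) JE JM (Torus.proj L x)|
      ≤ (N : ℝ) ^ 2 * polyakovCorrelation (L₀ := L₀) (znRep 2) ((N : ℝ) * JE) ((N : ℝ) * JM) (Torus.proj L x) :=
        specialUnitaryGroup_abs_polyakovCorrelation_le_zn_of_neZero (L₀ := L₀) hN hJE hJM _
    _ ≤ (N : ℝ) ^ 2 * θ ^ (L₀ * (Site.supNorm x / (R + 1))) := by
        rw [polyakovCorrelation_znRep_two_eq_z2Rep]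
        exact mul_le_mul_of_nonneg_left h2 (by positivity)

/-- ★ **`SU(2)`: Polyakov confinement at every temperature and every `J_M` for `2J_E < β_c(d)`.**
[cite: BorgsSeiler1983, §II.4 (II.55)–(II.56) (p. 343); §IV (pp. 358–359)] -/
theorem su2_tendsto_zero_of_lt_criticalBeta (hd : 2 ≤ d) (L₀ : ℕ) [NeZero L₀] {JE JM : ℝ} (hJE : 0 ≤ JE)
    (hJEc : 2 * JE < criticalBeta d) (hJM : 0 ≤ JM) {Ginf : (Fin d → ℤ) → ℝ}
    (hG : IsThermodynamicLimit (d := d) (L₀ := L₀) (fundamentalRep (Fin 2)) JE JM Ginf) :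
    Tendsto Ginf cofinite (𝓝 0) :=
  suN_tendsto_zero_of_even_of_lt_criticalBeta hd (dvd_refl 2) L₀ hJE (by exact_mod_cast hJEc) hJM hG

/-- ★ **`U(N)`: Polyakov confinement at every temperature and every `J_M` for `N J_E < β_c(d)`.**
[cite: BorgsSeiler1983, §II.4 (II.55)–(II.56) (p. 343); §IV (pp. 358–359)] -/
theorem unitaryGroup_tendsto_zero_of_lt_criticalBeta (hd : 2 ≤ d) {N : ℕ} (L₀ : ℕ) [NeZero L₀]
    {JE JM : ℝ} (hJE : 0 ≤ JE) (hJEc : (N : ℝ) * JE < criticalBeta d) (hJM : 0 ≤ JM)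
    {Ginf : (Fin d → ℤ) → ℝ}
    (hG : IsThermodynamicLimit (d := d) (L₀ := L₀) (unitaryFundamentalRep (Fin N) ℂ) JE JM Ginf) :
    Tendsto Ginf cofinite (𝓝 0) := by
  obtain ⟨R, θ, hR, hθ0, hθ1, hdec⟩ :=
    z2_polyakovCorrelation_decay_of_lt_criticalBeta hd (by positivity : 0 ≤ (N : ℝ) * JE) hJEc
  refine tendsto_zero_of_uniform_decay (d := d) (unitaryFundamentalRep (Fin N) ℂ) L₀ (C := (N : ℝ) ^ 2)
    (R := R) hθ0 hθ1 (fun L _ hL x hx => ?_) hG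
  have hL3 : 3 ≤ L := by omega
  have h2 := (hdec L₀ ((N : ℝ) * JM) (by positivity) L hL x hx).2
  have h1 := ThermalCentre.abs_polyakovCorrelation_le_zn_of_neZero (d := d) (L₀ := L₀) (L := L)
    (unitaryFundamentalRep (Fin N) ℂ) (pmOneUnitary N) (continuous_unitaryFundamentalRep (Fin N) ℂ)
    (fun g => g.2) (pmOneUnitary_mem_center N) (fun _ => rfl) hJE hJM (Torus.proj L x)
  refine h1.trans ?_
  rw [polyakovCorrelation_znRep_two_eq_z2Rep]
  exact mul_le_mul_of_nonneg_left h2 (by positivity)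

/-- **No Polyakov long-range order for `SU(N)`, `N` even, when `N J_E < β_c(d)`** (`d ≥ 2`, every `L₀`,
every `J_M ≥ 0`); equivalently long-range order forces `N J_E ≥ β_c(d)`: a temperature-independent lower
bound on Borgs–Seiler's deconfining coupling. [cite: BorgsSeiler1983, §III.2 Thm III.7 (p. 353); §IV (p. 359)] -/
theorem suN_criticalBeta_le_of_even_of_hasPolyakovLongRangeOrder (hd : 2 ≤ d) {N : ℕ} (hN : 2 ∣ N)
    (L₀ : ℕ) [NeZero L₀] {JE JM : ℝ} (hJE : 0 ≤ JE) (hJM : 0 ≤ JM)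
    (h : HasPolyakovLongRangeOrder d L₀ (fundamentalRep (Fin N)) JE JM) : criticalBeta d ≤ (N : ℝ) * JE := by
  by_contra hlt
  push Not at hlt
  obtain ⟨Ginf, hG⟩ := exists_isThermodynamicLimit (d := d) (L₀ := L₀) (fundamentalRep (Fin N))
    (continuous_fundamentalRep (Fin N)) fundamentalRep_mem_unitaryGroup JE JM
  exact h Ginf hG (suN_tendsto_zero_of_even_of_lt_criticalBeta hd hN L₀ hJE hlt hJM hG)

/-- **`SU(2)`: Polyakov long-range order forces `J_E ≥ β_c(d)/2`** at every temporal extent. [cite: BorgsSeiler1983, §III.2 Thm III.7 (p. 353); §IV (p. 359)] -/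
theorem su2_criticalBeta_le_of_hasPolyakovLongRangeOrder (hd : 2 ≤ d) (L₀ : ℕ) [NeZero L₀] {JE JM : ℝ}
    (hJE : 0 ≤ JE) (hJM : 0 ≤ JM) (h : HasPolyakovLongRangeOrder d L₀ (fundamentalRep (Fin 2)) JE JM) :
    criticalBeta d / 2 ≤ JE := by
  have := suN_criticalBeta_le_of_even_of_hasPolyakovLongRangeOrder hd (dvd_refl 2) L₀ hJE hJM h
  push_cast at this
  linarith

/-- **`U(N)`: Polyakov long-range order forces `N J_E ≥ β_c(d)`** at every temporal extent. [cite: BorgsSeiler1983, §III.2 Thm III.7 (p. 353); §IV (p. 359)] -/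
theorem unitaryGroup_criticalBeta_le_of_hasPolyakovLongRangeOrder (hd : 2 ≤ d) {N : ℕ} (L₀ : ℕ) [NeZero L₀]
    {JE JM : ℝ} (hJE : 0 ≤ JE) (hJM : 0 ≤ JM)
    (h : HasPolyakovLongRangeOrder d L₀ (unitaryFundamentalRep (Fin N) ℂ) JE JM) :
    criticalBeta d ≤ (N : ℝ) * JE := by
  by_contra hlt
  push Not at hlt
  obtain ⟨Ginf, hG⟩ := exists_isThermodynamicLimit (d := d) (L₀ := L₀) (unitaryFundamentalRep (Fin N) ℂ)
    (continuous_unitaryFundamentalRep (Fin N) ℂ) (fun g => g.2) JE JM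
  exact h Ginf hG (unitaryGroup_tendsto_zero_of_lt_criticalBeta hd L₀ hJE hlt hJM hG)

/-- **The two-sided window for the `SU(2)` finite-temperature transition** (`d ≥ 3`, every `L₀`):
Borgs–Seiler's deconfinement (tree `isotropic_specialUnitary_holds`, from `FiniteTemperatureDeconfinement_holds`)
gives SOME `β₀(L₀)` with long-range order for all isotropic `β ≥ β₀`, and every such `β₀` is
`≥ β_c(d)/2` by this file. [cite: BorgsSeiler1983, §III.2 Thm III.7 (p. 353); §IV (pp. 357–359)] -/
theorem su2_deconfinement_threshold_ge (hd : 3 ≤ d) (L₀ : ℕ) [NeZero L₀] :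
    ∃ β₀ : ℝ, criticalBeta d / 2 ≤ β₀ ∧ ∀ β : ℝ, β₀ ≤ β →
      HasPolyakovLongRangeOrder d L₀ (fundamentalRep (Fin 2)) β β := by
  obtain ⟨β₀, hβ₀, hLRO⟩ := isotropic_specialUnitary_holds (N := 2) le_rfl hd L₀
  exact ⟨β₀, su2_criticalBeta_le_of_hasPolyakovLongRangeOrder (by omega) L₀ hβ₀.le hβ₀.le (hLRO β₀ le_rfl), hLRO⟩

end CentreIsing

/-! ### 4. Central involutions: the general theorem; `U(1)` and `ℤ_{2m}` -/

section CentralSign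

open Z2Thermal

variable {d L₀ L : ℕ} {G : Type*} [Group G] [TopologicalSpace G] [IsTopologicalGroup G]
  [CompactSpace G] [MeasurableSpace G] [BorelSpace G] [SecondCountableTopology G] {N : ℕ}
  (ρ : G →* Matrix (Fin N) (Fin N) ℂ)

/-- ★ **Central involutions: the general stack bound.** For every compact gauge group `G`, every
continuous unitary representation `ρ` and every homomorphism `ι : {±1} → Z(G)` with `ρ(ι(z)) = z·1`,
`|G_L^{G,ρ}(x; J_E, J_M)| ≤ N² (⟨σ_0σ_x⟩^{Ising}_{(ℤ/L)^d, N J_E})^{L₀}` for `J_E, J_M ≥ 0`, `L ≥ 3`,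
every `L₀` and every `x` (centre domination to `{±1}` ∘ the `J_M → ∞` Griffiths bound).
[cite: Grosse1988, §4.2.4 eq. (4.134)] [cite: BorgsSeiler1983, §IV (pp. 358–359)] -/
theorem abs_polyakovCorrelation_le_isingTorus_pow_of_centralSign [NeZero L₀] [NeZero L]
    (ι : ↥(rootsOfUnityCircle 2) →* G) (hρ : Continuous ρ)
    (hρu : ∀ g, ρ g ∈ Matrix.unitaryGroup (Fin N) ℂ) (hι : ∀ z, ι z ∈ Subgroup.center G)
    (hρι : ∀ z, ρ (ι z) = (((z : Circle) : ℂ)) • (1 : Matrix (Fin N) (Fin N) ℂ))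
    (hL : 3 ≤ L) {JE JM : ℝ} (hJE : 0 ≤ JE) (hJM : 0 ≤ JM) (x : Fin d → ZMod L) :
    |polyakovCorrelation (L₀ := L₀) ρ JE JM x| ≤
      (N : ℝ) ^ 2 * torusTwoPoint (isingTorusMeasure d L ((N : ℝ) * JE) 0) x ^ L₀ :=
  (ThermalCentre.abs_polyakovCorrelation_le_zn_of_neZero (d := d) (L₀ := L₀) (L := L) ρ ι hρ hρu hι
    hρι hJE hJM x).trans (mul_le_mul_of_nonneg_left
      (zn2_polyakovCorrelation_le_isingTorus_pow hL (by positivity) (by positivity) x) (by positivity))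

/-- ★ **Central involutions: temperature-independent Polyakov confinement for `N J_E < β_c(d)`.**
Under the hypotheses of `abs_polyakovCorrelation_le_isingTorus_pow_of_centralSign`, for `d ≥ 2`,
`0 ≤ J_E` with `N·J_E < β_c(d)` and every `J_M ≥ 0`, at EVERY temporal extent `L₀` every
thermodynamic limit of the Polyakov two-point function tends to `0`.
[cite: BorgsSeiler1983, §II.4 (II.55)–(II.56) (p. 343); §IV (pp. 358–359)] -/
theorem tendsto_zero_of_centralSign_of_lt_criticalBeta (hd : 2 ≤ d) (ι : ↥(rootsOfUnityCircle 2) →* G)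
    (hρ : Continuous ρ) (hρu : ∀ g, ρ g ∈ Matrix.unitaryGroup (Fin N) ℂ)
    (hι : ∀ z, ι z ∈ Subgroup.center G)
    (hρι : ∀ z, ρ (ι z) = (((z : Circle) : ℂ)) • (1 : Matrix (Fin N) (Fin N) ℂ))
    (L₀ : ℕ) [NeZero L₀] {JE JM : ℝ} (hJE : 0 ≤ JE) (hJEc : (N : ℝ) * JE < criticalBeta d)
    (hJM : 0 ≤ JM) {Ginf : (Fin d → ℤ) → ℝ}
    (hG : IsThermodynamicLimit (d := d) (L₀ := L₀) ρ JE JM Ginf) :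
    Tendsto Ginf cofinite (𝓝 0) := by
  obtain ⟨R, θ, hR, hθ0, hθ1, hdec⟩ :=
    z2_polyakovCorrelation_decay_of_lt_criticalBeta hd (by positivity : 0 ≤ (N : ℝ) * JE) hJEc
  refine tendsto_zero_of_uniform_decay (d := d) ρ L₀ (C := (N : ℝ) ^ 2) (R := R) hθ0 hθ1
    (fun L _ hL x hx => ?_) hG
  have h2 := (hdec L₀ ((N : ℝ) * JM) (by positivity) L hL x hx).2
  have h1 := ThermalCentre.abs_polyakovCorrelation_le_zn_of_neZero (d := d) (L₀ := L₀) (L := L) ρ ι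
    hρ hρu hι hρι hJE hJM (Torus.proj L x)
  refine h1.trans ?_
  rw [polyakovCorrelation_znRep_two_eq_z2Rep]
  exact mul_le_mul_of_nonneg_left h2 (by positivity)

/-- **Central involutions: Polyakov long-range order forces `N J_E ≥ β_c(d)`** at every temporal
extent (`d ≥ 2`, `J_E, J_M ≥ 0`). [cite: BorgsSeiler1983, §III.2 Thm III.7 (p. 353); §IV (p. 359)] -/
theorem criticalBeta_le_of_centralSign_of_hasPolyakovLongRangeOrder (hd : 2 ≤ d)
    (ι : ↥(rootsOfUnityCircle 2) →* G) (hρ : Continuous ρ)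
    (hρu : ∀ g, ρ g ∈ Matrix.unitaryGroup (Fin N) ℂ) (hι : ∀ z, ι z ∈ Subgroup.center G)
    (hρι : ∀ z, ρ (ι z) = (((z : Circle) : ℂ)) • (1 : Matrix (Fin N) (Fin N) ℂ))
    (L₀ : ℕ) [NeZero L₀] {JE JM : ℝ} (hJE : 0 ≤ JE) (hJM : 0 ≤ JM)
    (h : HasPolyakovLongRangeOrder d L₀ ρ JE JM) : criticalBeta d ≤ (N : ℝ) * JE := by
  by_contra hlt
  push Not at hlt
  obtain ⟨Ginf, hG⟩ := exists_isThermodynamicLimit (d := d) (L₀ := L₀) ρ hρ hρu JE JM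
  exact h Ginf hG (tendsto_zero_of_centralSign_of_lt_criticalBeta ρ hd ι hρ hρu hι hρι L₀ hJE hlt hJM hG)

/-! #### `U(1)` -/

/-- `{±1} ⊂ U(1)` is central (the circle is abelian). [folklore] -/
private theorem subtype_two_mem_center (z : ↥(rootsOfUnityCircle 2)) :
    (rootsOfUnityCircle 2).subtype z ∈ Subgroup.center Circle :=
  Subgroup.mem_center_iff.2 fun g => mul_comm g _

/-- `u1Rep z = z·1`. [folklore] -/
private theorem u1Rep_eq_smul_one (z : Circle) : u1Rep z = ((z : ℂ)) • (1 : Matrix (Fin 1) (Fin 1) ℂ) := by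
  rw [u1Rep_apply, Matrix.scalar_apply, Matrix.smul_one_eq_diagonal]

/-- **`U(1)`: `0 ≤ G_L^{U(1)}(x; J_E, J_M) ≤ (⟨σ_0σ_x⟩^{Ising}_{(ℤ/L)^d, J_E})^{L₀}`** for `J_E, J_M ≥ 0`,
`L ≥ 3` (domination by the subgroup `{±1}`, then the `J_M → ∞` Griffiths bound; the lower bound is
Griffiths' first inequality, tree `u1_polyakovCorrelation_nonneg`). [cite: BorgsSeiler1983, §IV (pp. 358–359)] -/
theorem u1_polyakovCorrelation_le_isingTorus_pow [NeZero L₀] [NeZero L] (hL : 3 ≤ L) {JE JM : ℝ}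
    (hJE : 0 ≤ JE) (hJM : 0 ≤ JM) (x : Fin d → ZMod L) :
    0 ≤ polyakovCorrelation (L₀ := L₀) u1Rep JE JM x ∧
      polyakovCorrelation (L₀ := L₀) u1Rep JE JM x ≤ torusTwoPoint (isingTorusMeasure d L JE 0) x ^ L₀ := by
  have hnn : 0 ≤ polyakovCorrelation (L₀ := L₀) u1Rep JE JM x := u1_polyakovCorrelation_nonneg hJE hJM x
  refine ⟨hnn, ?_⟩
  have h := abs_polyakovCorrelation_le_isingTorus_pow_of_centralSign (d := d) (L₀ := L₀) (L := L) u1Rep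
    (rootsOfUnityCircle 2).subtype continuous_u1Rep u1Rep_mem_unitaryGroup subtype_two_mem_center
    (fun z => u1Rep_eq_smul_one _) hL hJE hJM x
  rw [abs_of_nonneg hnn] at h
  simpa using h

/-- **`U(1)`: Polyakov confinement at every temperature and every `J_M ≥ 0` for `J_E < β_c(d)`**
(`d ≥ 2`). [cite: BorgsSeiler1983, §II.4 (II.55)–(II.56) (p. 343); §IV (pp. 358–359)] -/
theorem u1_tendsto_zero_of_lt_criticalBeta (hd : 2 ≤ d) (L₀ : ℕ) [NeZero L₀] {JE JM : ℝ} (hJE : 0 ≤ JE)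
    (hJEc : JE < criticalBeta d) (hJM : 0 ≤ JM) {Ginf : (Fin d → ℤ) → ℝ}
    (hG : IsThermodynamicLimit (d := d) (L₀ := L₀) u1Rep JE JM Ginf) :
    Tendsto Ginf cofinite (𝓝 0) :=
  tendsto_zero_of_centralSign_of_lt_criticalBeta u1Rep hd (rootsOfUnityCircle 2).subtype continuous_u1Rep
    u1Rep_mem_unitaryGroup subtype_two_mem_center (fun z => u1Rep_eq_smul_one _) L₀ hJE
    (by simpa using hJEc) hJM hG

/-- **`U(1)`: Polyakov long-range order forces `J_E ≥ β_c(d)`** (`d ≥ 2`, every `L₀`, `J_M ≥ 0`).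
[cite: BorgsSeiler1983, §III.3 (p. 354); §IV (p. 359)] -/
theorem u1_criticalBeta_le_of_hasPolyakovLongRangeOrder (hd : 2 ≤ d) (L₀ : ℕ) [NeZero L₀] {JE JM : ℝ}
    (hJE : 0 ≤ JE) (hJM : 0 ≤ JM) (h : HasPolyakovLongRangeOrder d L₀ u1Rep JE JM) :
    criticalBeta d ≤ JE := by
  have := criticalBeta_le_of_centralSign_of_hasPolyakovLongRangeOrder u1Rep hd (rootsOfUnityCircle 2).subtype
    continuous_u1Rep u1Rep_mem_unitaryGroup subtype_two_mem_center (fun z => u1Rep_eq_smul_one _) L₀ hJE hJM h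
  simpa using this

/-- ★ **The two-sided window for the `U(1)` finite-temperature transition** (`d ≥ 3`, every temporal
extent `L₀`): NO Polyakov long-range order for `0 ≤ J_E < β_c(d)`, `J_M ≥ 0` (this file), and Polyakov
long-range order for `J_E > 2L₀(d·I_d + 1)`, `J_M > 0` (Borgs–Seiler Lemma III.9, tree
`u1_hasPolyakovLongRangeOrder_of_lt`); the lower edge is uniform in `L₀`, the upper edge linear in `L₀`.
[cite: BorgsSeiler1983, §III.3 Lemma III.9, (III.87)–(III.89) (pp. 356–357); §IV (pp. 358–359)] -/
theorem u1_transition_window (hd : 3 ≤ d) (L₀ : ℕ) [NeZero L₀] :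
    (∀ JE JM : ℝ, 0 ≤ JE → JE < criticalBeta d → 0 ≤ JM → ¬ HasPolyakovLongRangeOrder d L₀ u1Rep JE JM) ∧
    (∀ JE JM : ℝ, 2 * (L₀ : ℝ) * ((d : ℝ) * latticeGreen (0 : Fin d → ℤ) + 1) < JE → 0 < JM →
      HasPolyakovLongRangeOrder d L₀ u1Rep JE JM) :=
  ⟨fun _ _ hJE hJEc hJM h => absurd (u1_criticalBeta_le_of_hasPolyakovLongRangeOrder (by omega) L₀ hJE hJM h)
      (not_le.2 hJEc),
    fun _ _ hJE hJM => u1_hasPolyakovLongRangeOrder_of_lt hd L₀ hJE hJM⟩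

/-- **Curiosity: the `d`-dimensional Ising critical point bounded through `U(1)` gauge theory in
`d + 1` dimensions**: `β_c(d) ≤ 2L₀(d·I_d + 1) + 1` for every `d ≥ 3` and every `L₀ ≥ 1`
(`I_d = latticeGreen 0`), since at `J_E = J_M = 2L₀(d·I_d + 1) + 1` the `U(1)` theory has Polyakov
long-range order. [cite: BorgsSeiler1983, §III.3 Lemma III.9 (pp. 356–357); §IV (pp. 358–359)] -/
theorem criticalBeta_le_of_u1_deconfinement (hd : 3 ≤ d) (L₀ : ℕ) [NeZero L₀] :
    criticalBeta d ≤ 2 * (L₀ : ℝ) * ((d : ℝ) * latticeGreen (0 : Fin d → ℤ) + 1) + 1 := by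
  have hI : 0 ≤ latticeGreen (0 : Fin d → ℤ) := (latticeGreen_pos d hd 0).le
  have hpos : 0 < 2 * (L₀ : ℝ) * ((d : ℝ) * latticeGreen (0 : Fin d → ℤ) + 1) + 1 := by positivity
  exact u1_criticalBeta_le_of_hasPolyakovLongRangeOrder (by omega) L₀ hpos.le hpos.le
    (u1_hasPolyakovLongRangeOrder_of_lt hd L₀ (lt_add_one _) hpos)

/-! #### `ℤ_n`, `n` even -/

/-- `{±1} ⊆ ℤ_n` for even `n`. [folklore] -/
private theorem rootsOfUnityCircle_two_le {n : ℕ} (hn : 2 ∣ n) : rootsOfUnityCircle 2 ≤ rootsOfUnityCircle n := by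
  intro z hz
  rw [mem_rootsOfUnityCircle] at hz ⊢
  obtain ⟨k, rfl⟩ := hn
  rw [pow_mul, hz, one_pow]

/-- `{±1} ⊆ ℤ_n` is central. [folklore] -/
private theorem inclusion_mem_center {n : ℕ} (hn : 2 ∣ n) (z : ↥(rootsOfUnityCircle 2)) :
    Subgroup.inclusion (rootsOfUnityCircle_two_le hn) z ∈ Subgroup.center ↥(rootsOfUnityCircle n) :=
  Subgroup.mem_center_iff.2 fun g => mul_comm g _

/-- `znRep n` restricted to `{±1}` is `z ↦ z·1`. [folklore] -/
private theorem znRep_inclusion {n : ℕ} (hn : 2 ∣ n) (z : ↥(rootsOfUnityCircle 2)) :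
    znRep n (Subgroup.inclusion (rootsOfUnityCircle_two_le hn) z) =
      (((z : Circle) : ℂ)) • (1 : Matrix (Fin 1) (Fin 1) ℂ) := by
  rw [znRep_apply, Subgroup.coe_inclusion, u1Rep_eq_smul_one]

/-- **`ℤ_n`, `n ≥ 2` even: `0 ≤ G_L^{ℤ_n}(x; J_E, J_M) ≤ (⟨σ_0σ_x⟩^{Ising}_{(ℤ/L)^d, J_E})^{L₀}`** for
`J_E, J_M ≥ 0`, `L ≥ 3` (`n = 0` is `U(1)`, `u1_polyakovCorrelation_le_isingTorus_pow`). [cite: BorgsSeiler1983, §IV (pp. 358–359)] -/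
theorem zn_polyakovCorrelation_le_isingTorus_pow_of_even [NeZero L₀] [NeZero L] {n : ℕ} [NeZero n]
    (hn : 2 ∣ n) (hL : 3 ≤ L) {JE JM : ℝ} (hJE : 0 ≤ JE) (hJM : 0 ≤ JM) (x : Fin d → ZMod L) :
    0 ≤ polyakovCorrelation (L₀ := L₀) (znRep n) JE JM x ∧
      polyakovCorrelation (L₀ := L₀) (znRep n) JE JM x ≤
        torusTwoPoint (isingTorusMeasure d L JE 0) x ^ L₀ := by
  have hnn : 0 ≤ polyakovCorrelation (L₀ := L₀) (znRep n) JE JM x :=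
    ThermalCentre.zn_polyakovCorrelation_nonneg_of_neZero hJE hJM x
  refine ⟨hnn, ?_⟩
  have h := abs_polyakovCorrelation_le_isingTorus_pow_of_centralSign (d := d) (L₀ := L₀) (L := L) (znRep n)
    (Subgroup.inclusion (rootsOfUnityCircle_two_le hn)) (continuous_znRep n) (znRep_mem_unitaryGroup n)
    (inclusion_mem_center hn) (znRep_inclusion hn) hL hJE hJM x
  rw [abs_of_nonneg hnn] at h
  simpa using h

/-- **`ℤ_n`, `n` even: Polyakov confinement at every temperature and every `J_M ≥ 0` for
`J_E < β_c(d)`** (`d ≥ 2`). [cite: BorgsSeiler1983, §II.4 (II.55)–(II.56) (p. 343); §IV (pp. 358–359)] -/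
theorem zn_tendsto_zero_of_even_of_lt_criticalBeta (hd : 2 ≤ d) {n : ℕ} (hn : 2 ∣ n) (L₀ : ℕ) [NeZero L₀]
    {JE JM : ℝ} (hJE : 0 ≤ JE) (hJEc : JE < criticalBeta d) (hJM : 0 ≤ JM) {Ginf : (Fin d → ℤ) → ℝ}
    (hG : IsThermodynamicLimit (d := d) (L₀ := L₀) (znRep n) JE JM Ginf) :
    Tendsto Ginf cofinite (𝓝 0) :=
  tendsto_zero_of_centralSign_of_lt_criticalBeta (znRep n) hd
    (Subgroup.inclusion (rootsOfUnityCircle_two_le hn)) (continuous_znRep n) (znRep_mem_unitaryGroup n)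
    (inclusion_mem_center hn) (znRep_inclusion hn) L₀ hJE (by simpa using hJEc) hJM hG

/-- **`ℤ_n`, `n` even: Polyakov long-range order forces `J_E ≥ β_c(d)`** (`d ≥ 2`, every `L₀`,
`J_M ≥ 0`). [cite: BorgsSeiler1983, §III.3 (p. 354); §IV (p. 359)] -/
theorem zn_criticalBeta_le_of_even_of_hasPolyakovLongRangeOrder (hd : 2 ≤ d) {n : ℕ} (hn : 2 ∣ n)
    (L₀ : ℕ) [NeZero L₀] {JE JM : ℝ} (hJE : 0 ≤ JE) (hJM : 0 ≤ JM)
    (h : HasPolyakovLongRangeOrder d L₀ (znRep n) JE JM) : criticalBeta d ≤ JE := by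
  have := criticalBeta_le_of_centralSign_of_hasPolyakovLongRangeOrder (znRep n) hd
    (Subgroup.inclusion (rootsOfUnityCircle_two_le hn)) (continuous_znRep n) (znRep_mem_unitaryGroup n)
    (inclusion_mem_center hn) (znRep_inclusion hn) L₀ hJE hJM h
  simpa using this

/-- **The two-sided window for the `ℤ_n` finite-temperature transition, `n` even** (`d ≥ 3`, every
`L₀`): no Polyakov long-range order for `0 ≤ J_E < β_c(d)`, `J_M ≥ 0`; long-range order for
`J_E > 2L₀(d·I_d + 1)`, `J_M > 0` (tree `zn_hasPolyakovLongRangeOrder_of_lt`).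
[cite: BorgsSeiler1983, §III.3 (p. 354), Lemma III.9 (pp. 356–357); §IV (pp. 358–359)] -/
theorem zn_transition_window_of_even (hd : 3 ≤ d) {n : ℕ} (hn : 2 ∣ n) (L₀ : ℕ) [NeZero L₀] :
    (∀ JE JM : ℝ, 0 ≤ JE → JE < criticalBeta d → 0 ≤ JM →
      ¬ HasPolyakovLongRangeOrder d L₀ (znRep n) JE JM) ∧
    (∀ JE JM : ℝ, 2 * (L₀ : ℝ) * ((d : ℝ) * latticeGreen (0 : Fin d → ℤ) + 1) < JE → 0 < JM →
      HasPolyakovLongRangeOrder d L₀ (znRep n) JE JM) :=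
  ⟨fun _ _ hJE hJEc hJM h =>
      absurd (zn_criticalBeta_le_of_even_of_hasPolyakovLongRangeOrder (by omega) hn L₀ hJE hJM h) (not_le.2 hJEc),
    fun _ _ hJE hJM => zn_hasPolyakovLongRangeOrder_of_lt n hd L₀ hJE hJM⟩

end CentralSign

end Literature.MathematicalPhysics.QuantumFieldTheory

end
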